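import Literature.AlgebraicGeometry.Frobenioids.BaseCategoryTheoreticitySchemaNegativeThm34
import HarnessLib

/-!
# Frobenioids I, Prop. 3.11 (i) and Remark 3.4.1: the universal closures of the typed per-instance
# schemata over the BARE operations interface are FALSE

Mochizuki, *The geometry of Frobenioids I: the general theory*, Kyushu J. Math. **62** (2008)
293–400, Prop. 3.11 (i) p. 73, Rem. 3.4.1 p. 69 [cite: MochizukiFrdI2008, Prop. 3.11 (i) p.73].

PROOF-ONLY companion (no definitions, no instances) of `BaseCategoryTheoreticity.lean` (seat
abc-iut-f-018, float rows of its own trunk: FACT-LIST F-0896 `PreFrobenioidData.Prop311i`, F-0899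
`PreFrobenioidData.Remark341`; kernel_closedness `parametrised`). As for the sibling rows settled in
`BaseCategoryTheoreticitySchemaNegativeThm34.lean`, both declarations are conclusion predicates in the
operations `S : PreFrobenioidData C D` of Def. 1.1 (iv) (NOT the Frobenioid axioms of Def. 1.3) — and, for
the Remark, an arbitrary equivalence `Ψ`; the paper asserts them for Frobenioids, where they are PROVED in
the tree: `FrdI.Prop311i_holds` (`UnitEquivalenceProofs.lean`, F-0704) and `FrdI.Remark341_holds`
(`BaseCategoryTheoreticityProofs.lean`, F-0709) — cited, not restated. This file records that the
UNIVERSAL CLOSURES over the bare interface (level `0`) are false: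

* Prop. 3.11 (i) ("`C → F_Φ` is an equivalence", typed as: arrows determined by `(Base, deg_Fr)`, every
  pair `(f, n)` realised, every object of `D` hit): for the junk operations on `B(N_{≥1})` with base
  CONSTANT at the object of `B(ℤ) = SingleObj ℤ` (`Φ = 0`, `deg_Fr = id`; the setting of Prop. 3.11
  holds — isotropic, unit-trivial, group-like, base of FSMFF-type) no arrow lies over `1 ∈ ℤ`, so
  fullness fails;
* Rem. 3.4.1 ("degree-preserving `Ψ^{±1}` preserve base-isomorphisms", group-like quasi-isotropic type):
  with `Ψ = 𝟭` on `B(N_{≥1})`, `Φ = 0`, `deg_Fr = id` on both sides, but `Base₁` constant (every arrow a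
  base-isomorphism) and `Base₂ = 𝟭_{B(N_{≥1})}` (the base-isomorphisms are the invertible arrows, i.e.
  `1` only), the arrow `2` is a base-isomorphism for the first and not for the second.

A refuted closure is a statement about the typing, not about the paper; no statement of the paper is
restated or strengthened; no side is taken on [IUTchIII] Cor. 3.12.
-/

namespace Literature.AlgebraicGeometry.Frobenioids

open CategoryTheory

namespace PreFrobenioidData

namespace SchemaNegativeThm34

/-- Junk operations on `B(N_{≥1})` lying over ITSELF by the identity functor (`Φ = 0`, `Div = 0`,
`deg_Fr = id`): linear arrows are `1`, hence invertible; the base-isomorphisms are exactly the invertible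
arrows. NOT the operations of any Frobenioid; a counterexample carrier only.
[cite: MochizukiFrdI2008, Def. 1.1 (iv) p.20] -/
theorem exists_ops_idBase :
    ∃ S : PreFrobenioidData.{0} (SingleObj ℕ+) (SingleObj ℕ+),
      (∀ {x y : SingleObj ℕ+} (φ : x ⟶ y), S.degFr φ = φ) ∧
      (∀ {x y : SingleObj ℕ+} (φ : x ⟶ y), S.IsLinear φ → IsIso φ) ∧
      (∀ {x y : SingleObj ℕ+} (φ : x ⟶ y), S.IsBaseIso φ → IsIso φ) ∧
      (∀ (Y : SingleObj ℕ+) (m : S.Mon Y), m = 1) :=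
  ⟨{ base := 𝟭 _
     Mon := fun _ => PUnit
     pull := fun _ => MonoidHom.id _
     pull_id := fun _ _ => rfl
     pull_comp := fun _ _ _ => rfl
     div := fun _ => 1
     degFr := fun φ => φ
     div_id := fun _ => rfl
     div_comp := fun _ _ => rfl
     degFr_id := fun _ => rfl
     degFr_comp := fun ψ φ => by rw [SingleObj.comp_as_mul, mul_comm] },
    fun _ => rfl, fun φ hφ => CorSchemaNegative.isIso_of_eq_one φ hφ, fun _ h => h, fun _ _ => rfl⟩

end SchemaNegativeThm34

open SchemaNegativeThm34

/-! ### The two refutations -/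

/-- **The universal closure of the typed `PreFrobenioidData.Prop311i` is false** (F-0896): for the junk
operations on `B(N_{≥1})` with base constant at the object of `SingleObj ℤ` (setting of Prop. 3.11
satisfied) every arrow lies over the identity, so no arrow lies over `1 ∈ ℤ` and the fullness clause
fails. The INSTANCE FORM over Frobenioids is the closed fact `FrdI.Prop311i_holds` (F-0704).
[cite: MochizukiFrdI2008, Prop. 3.11 (i) p.73] -/
theorem not_forall_prop311i :
    ¬ ∀ {C : Type} [Category.{0} C] {D : Type} [Category.{0} D] (S : PreFrobenioidData.{0} C D),
        S.Prop311i := by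
  intro h
  have hD : IsOfFSMFFType (SingleObj (Multiplicative ℤ)) :=
    (⟨fun f _ => IsIso.of_groupoid f⟩ : IsOfFSMType (SingleObj (Multiplicative ℤ))).isOfFSMFFType
  obtain ⟨S, -, hlin, -, -, hbid, -, hzero, -⟩ :=
    exists_ops (SingleObj.star (Multiplicative ℤ)) PUnit (MonoidHom.id ℕ+) fun _ h => h
  obtain ⟨-, hfull, -⟩ := h S (prop311Setting S hlin (hzero inferInstance) hD)
  obtain ⟨φ, hφ, -⟩ := hfull (SingleObj.star ℕ+) (SingleObj.star ℕ+) (Multiplicative.ofAdd (1 : ℤ)) 1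
  have h1 : S.base.map φ = 𝟙 _ := hbid φ
  rw [hφ, SingleObj.id_as_one] at h1
  have h2 := congrArg Multiplicative.toAdd h1
  simp at h2

/-- **The universal closure of the typed `PreFrobenioidData.Remark341` is false** (F-0899): with
`Ψ = 𝟭` on `B(N_{≥1})`, `Φ = 0` and `deg_Fr = id` on both sides (group-like, quasi-isotropic; `Ψ^{±1}`
preserve Frobenius degrees), `Base₁` constant over `Discrete PUnit` and `Base₂ = 𝟭`, the arrow `2` is a
base-isomorphism for the first operations and not for the second. The INSTANCE FORM over Frobenioids is
the closed fact `FrdI.Remark341_holds` (F-0709). [cite: MochizukiFrdI2008, Rem. 3.4.1 p.69] -/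
theorem not_forall_remark341 :
    ¬ ∀ {C₁ : Type} [Category.{0} C₁] {D₁ : Type} [Category.{0} D₁]
        {C₂ : Type} [Category.{0} C₂] {D₂ : Type} [Category.{0} D₂]
        (S₁ : PreFrobenioidData.{0} C₁ D₁) (S₂ : PreFrobenioidData.{0} C₂ D₂) (Ψ : C₁ ≌ C₂),
        S₁.Remark341 S₂ Ψ := by
  intro h
  obtain ⟨S₁, hdeg₁, hlin₁, -, hbase₁, -, -, hzero₁, -⟩ :=
    exists_ops (⟨⟨⟩⟩ : Discrete PUnit.{1}) PUnit (MonoidHom.id ℕ+) fun _ h => h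
  obtain ⟨S₂, hdeg₂, hlin₂, hbase₂, hzero₂⟩ := exists_ops_idBase
  obtain ⟨hP, -⟩ := h S₁ S₂ CategoryTheory.Equivalence.refl
    ⟨fun A m => hzero₁ inferInstance _ m⟩ ⟨fun A m => hzero₂ _ m⟩
    (isOfQuasiIsotropicType S₁ hlin₁) (isOfQuasiIsotropicType S₂ hlin₂)
    (fun A B φ => by rw [hdeg₂, hdeg₁]; rfl) (fun A B φ => by rw [hdeg₁, hdeg₂]; rfl)
  have hP' : ∀ ⦃A B : SingleObj ℕ+⦄ (φ : A ⟶ B), S₁.IsBaseIso φ →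
      S₂.IsBaseIso ((CategoryTheory.Equivalence.refl (C := SingleObj ℕ+)).functor.map φ) := hP
  haveI := hbase₂ _ (hP' (A := SingleObj.star ℕ+) (B := SingleObj.star ℕ+) (2 : ℕ+) (hbase₁ _))
  have h2 : (2 : ℕ+) = 1 :=
    CorSchemaNegative.eq_one_of_isIso
      ((CategoryTheory.Equivalence.refl (C := SingleObj ℕ+)).functor.map
        (X := SingleObj.star ℕ+) (Y := SingleObj.star ℕ+) (2 : ℕ+))
  exact absurd h2 (by decide)

end PreFrobenioidData

end Literature.AlgebraicGeometry.Frobenioids
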